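import Mathlib
import Summits.Langlands.Langlands.Theorems.IwahoriTransientSplitCertificate

/-!
# IwahoriTransient — INERTIA ALGEBRA (DAG edge `SemistableShaping ⟸ W⁺ ∧ P(i) ∧ L∤R`, part 1) — lens-3 gen 26, cell `decomp-langlands`

The local algebra behind the DAG edge requested at critic row 372 / census v29 L1991 for the gen-25 deciding piece
SSH = `Theorems.IwahoriTransient.SemistableShaping` (a level-free pro-automorphic ρ is semistably shaped), upgrading the landed
CERTIFICATE (`IwahoriTransientSplitCertificate`: eigenvalue rigidity `eq_one_of_valued_lt`, `toyShaping_holds`) from EIGENVALUES to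
OPERATORS — the form in which the global assembly (part 2, blueprint HOME/lens-3/g26/dag/NEXT-g27.md) consumes it:

* `isNilpotent_mul_sub_one`           — commuting unipotents multiply to a unipotent (any ring);
* `eq_one_of_isNilpotent_sub_one_of_pow_eq_one` — a UNIPOTENT element of FINITE ORDER is trivial (any ℚ-algebra): the step
  «ρ_W(τ) = ρ(τ)·exp(−t(τ)N) is unipotent and of finite order on inertia ⇒ ρ_W(τ) = 1», i.e. unipotent inertia ⇒ Weil–Deligne parameter
  UNRAMIFIED ⇒ (dictionary fact IWD) Iwahori-fixed vectors;
* `pow_eq_one_of_isRoot_charpoly`     — if `M^k` is unipotent then every root of `charpoly M` is a `k`-th root of unity (Grothendieck's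
  quasi-unipotence, operator form ⇒ eigenvalue form), over any field;
* `charpoly_eq_X_sub_C_pow`, `isNilpotent_sub_one_of_charpoly` — all eigenvalues `1` ⇒ `charpoly M = (X−1)^n` ⇒ `M` unipotent
  (algebraically closed field; Cayley–Hamilton);
* MAIN `isNilpotent_sub_one_of_valued_lt` — a QUASI-UNIPOTENT matrix over `ℚ̄_ℓ` whose characteristic polynomial is coefficientwise within
  the items' radius `(ℓ⁻¹)^n` of `(X−1)^n` IS UNIPOTENT (certificate `eq_one_of_valued_lt` + the above): the avatar of a deep approximant
  at a tame inertia generator of a place where ρ is unramified has unipotent image — semistable SHAPE;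
* `wd_eq_one_of_valued_lt` — … and its Weil–Deligne inertia value `M·u` (u unipotent, commuting, `(M·u)^k = 1`) is `1`;
Companion files: `IwahoriTransientRoots` (ultrametric root continuity §5 and ROOT-PAIR MATCHING §9) and `IwahoriTransientGalois` (the GLOBAL
Galois inputs: integrality of eigenvalues, Chebotarev transfer, Grothendieck quasi-unipotence of inertia).  Mathlib + the certificate only;
no `def`; 0 sorry.
-/

set_option linter.dupNamespace false
set_option linter.unusedVariables false

namespace Summit.Langlands.Langlands.Theorems.IwahoriTransient

open scoped Polynomial Matrix
open Polynomial

/-! ## 1. Unipotent elements of finite order (any ℚ-algebra) -/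
section Unipotent
variable {A : Type*} [Ring A]

/-- commuting unipotents multiply to a unipotent. -/
theorem isNilpotent_mul_sub_one {a b : A} (ha : IsNilpotent (a - 1)) (hb : IsNilpotent (b - 1)) (hab : Commute a b) :
    IsNilpotent (a * b - 1) := by
  have hc : Commute (a - 1) (b - 1) := (hab.sub_left (Commute.one_left b)).sub_right (Commute.one_right _)
  have key : a * b - 1 = (a - 1) * (b - 1) + ((a - 1) + (b - 1)) := by noncomm_ring
  rw [key]
  have h1 : Commute ((a - 1) * (b - 1)) (a - 1) := Commute.mul_left (Commute.refl _) hc.symm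
  have h2 : Commute ((a - 1) * (b - 1)) (b - 1) := Commute.mul_left hc (Commute.refl _)
  exact (h1.add_right h2).isNilpotent_add (hc.isNilpotent_mul_right ha) (hc.isNilpotent_add ha hb)

/-- `g ^ i − 1 = (∑_{j<i} g^j) · (g − 1)` summed over `i < k`: `(∑_{i<k} g^i) − k = P · (g − 1)` with `P` a sum of powers of `g`. -/
theorem geom_sum_sub_natCast (g : A) (k : ℕ) :
    (∑ i ∈ Finset.range k, g ^ i) - (k : A) = (∑ i ∈ Finset.range k, ∑ j ∈ Finset.range i, g ^ j) * (g - 1) := by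
  rw [Finset.sum_mul]
  have : (k : A) = ∑ i ∈ Finset.range k, (1 : A) := by simp
  rw [this, ← Finset.sum_sub_distrib]
  refine Finset.sum_congr rfl fun i _ => ?_
  rw [geom_sum_mul]

variable [Algebra ℚ A]

/-- A UNIPOTENT element of FINITE ORDER in a ℚ-algebra is `1`.  (Inertia: `ρ_W(τ)` is unipotent — product of the unipotent `ρ(τ)` and
`exp(−t(τ)N)` — and of finite order, hence trivial: unipotent inertia means an UNRAMIFIED Weil–Deligne parameter.) -/
theorem eq_one_of_isNilpotent_sub_one_of_pow_eq_one {g : A} (hg : IsNilpotent (g - 1)) {k : ℕ} (hk : k ≠ 0) (hgk : g ^ k = 1) :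
    g = 1 := by
  set u : A := ∑ i ∈ Finset.range k, g ^ i with hu
  -- u · (g − 1) = g^k − 1 = 0
  have hu0 : u * (g - 1) = 0 := by rw [hu, geom_sum_mul, hgk, sub_self]
  -- u = k + P · (g − 1) with P · (g − 1) nilpotent
  set P : A := ∑ i ∈ Finset.range k, ∑ j ∈ Finset.range i, g ^ j with hP
  have hcommP : Commute P (g - 1) := by
    refine Commute.sum_left _ _ _ fun i _ => Commute.sum_left _ _ _ fun j _ => ?_
    exact ((Commute.refl g).pow_left j).sub_right (Commute.one_right _)
  have hnil : IsNilpotent (P * (g - 1)) := hcommP.isNilpotent_mul_left hg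
  have hdecomp : u = P * (g - 1) + (k : A) := by rw [← geom_sum_sub_natCast g k, hu]; abel
  have hunitk : IsUnit (k : A) := by
    have : (k : A) = algebraMap ℚ A (k : ℚ) := by simp
    rw [this]
    exact (IsUnit.mk0 (k : ℚ) (by exact_mod_cast hk)).map _
  have hcommk : Commute (P * (g - 1)) (k : A) := (Nat.cast_commute k _).symm
  have hunit : IsUnit u := by
    rw [hdecomp]
    exact hnil.isUnit_add_right_of_commute hunitk hcommk
  obtain ⟨w, hw⟩ := hunit
  have : g - 1 = 0 := by
    have h := congrArg (fun x => (↑w⁻¹ : A) * x) hu0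
    simpa [← mul_assoc, ← hw] using h
  exact sub_eq_zero.mp this

/-- packaged Weil–Deligne form: `M` unipotent, `u` unipotent, commuting, `(M·u)` of finite order ⇒ `M·u = 1`. -/
theorem mul_eq_one_of_unipotent_of_pow_eq_one {M u : A} (hM : IsNilpotent (M - 1)) (hu : IsNilpotent (u - 1)) (hc : Commute M u)
    {k : ℕ} (hk : k ≠ 0) (hfin : (M * u) ^ k = 1) : M * u = 1 :=
  eq_one_of_isNilpotent_sub_one_of_pow_eq_one (isNilpotent_mul_sub_one hM hu hc) hk hfin
end Unipotent

/-! ## 2. Quasi-unipotence: operator form ⇒ eigenvalue form (any field) -/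
section Eigen
variable {K : Type*} [Field K] {n : ℕ}

/-- an eigen-relation propagates to powers: `M v = c v ⇒ Mⁱ v = cⁱ v`. -/
theorem pow_mulVec_of_mulVec_eq_smul {M : Matrix (Fin n) (Fin n) K} {v : Fin n → K} {c : K} (h : M *ᵥ v = c • v) (i : ℕ) :
    (M ^ i) *ᵥ v = c ^ i • v := by
  induction i with
  | zero => simp
  | succ i ih => rw [pow_succ, ← Matrix.mulVec_mulVec, h, Matrix.mulVec_smul, ih, smul_smul, pow_succ, mul_comm]

/-- a root of the characteristic polynomial is an eigenvalue with an eigenvector. -/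
theorem exists_eigenvector_of_isRoot_charpoly (M : Matrix (Fin n) (Fin n) K) {ζ : K} (hζ : M.charpoly.IsRoot ζ) :
    ∃ v : Fin n → K, v ≠ 0 ∧ M *ᵥ v = ζ • v := by
  have hdet : (Matrix.scalar (Fin n) ζ - M).det = 0 := by rw [← Matrix.eval_charpoly]; exact hζ
  obtain ⟨v, hv, hv0⟩ := Matrix.exists_mulVec_eq_zero_iff.mpr hdet
  refine ⟨v, hv, ?_⟩
  rw [Matrix.sub_mulVec, sub_eq_zero] at hv0
  rw [← hv0, Matrix.scalar_apply, ← Matrix.diagonal_const_mulVec]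

/-- GROTHENDIECK, operator ⇒ eigenvalue: if `M^k` is unipotent then every root of `charpoly M` is a `k`-th root of unity. -/
theorem pow_eq_one_of_isRoot_charpoly (M : Matrix (Fin n) (Fin n) K) {k : ℕ} (hk : IsNilpotent (M ^ k - 1)) {ζ : K}
    (hζ : M.charpoly.IsRoot ζ) : ζ ^ k = 1 := by
  obtain ⟨v, hv, hMv⟩ := exists_eigenvector_of_isRoot_charpoly M hζ
  obtain ⟨m, hm⟩ := hk
  have hB : (M ^ k - 1) *ᵥ v = (ζ ^ k - 1) • v := by
    rw [Matrix.sub_mulVec, pow_mulVec_of_mulVec_eq_smul hMv, Matrix.one_mulVec, sub_smul, one_smul]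
  have hBm : ((M ^ k - 1) ^ m) *ᵥ v = (ζ ^ k - 1) ^ m • v := pow_mulVec_of_mulVec_eq_smul hB m
  rw [hm, Matrix.zero_mulVec] at hBm
  have h0 : (ζ ^ k - 1) ^ m = 0 := by
    by_contra hne
    exact hv (by simpa [hne] using (smul_eq_zero.mp hBm.symm))
  exact sub_eq_zero.mp ((pow_eq_zero_iff (by rintro rfl; simp at h0)).mp h0)
end Eigen

/-! ## 3. All eigenvalues 1 ⇒ unipotent (algebraically closed field; Cayley–Hamilton) -/
section AlgClosed
variable {K : Type*} [Field K] [IsAlgClosed K] {n : ℕ}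

/-- over an algebraically closed field: every root of `charpoly M` equals `1` ⇒ `charpoly M = (X − 1)^n`. -/
theorem charpoly_eq_X_sub_C_pow (M : Matrix (Fin n) (Fin n) K) (h : ∀ ζ, M.charpoly.IsRoot ζ → ζ = 1) :
    M.charpoly = (X - C 1) ^ n := by
  have hmon := M.charpoly_monic
  have hs : M.charpoly.Splits := IsAlgClosed.splits M.charpoly
  have hcard : M.charpoly.roots.card = n := by
    rw [← hs.natDegree_eq_card_roots, Matrix.charpoly_natDegree_eq_dim, Fintype.card_fin]
  have hroots : M.charpoly.roots = Multiset.replicate n 1 := by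
    refine Multiset.eq_replicate.mpr ⟨hcard, fun b hb => h b ?_⟩
    exact (Polynomial.mem_roots hmon.ne_zero).mp hb
  rw [hs.eq_prod_roots_of_monic hmon, hroots, Multiset.map_replicate, Multiset.prod_replicate]

omit [IsAlgClosed K] in
/-- Cayley–Hamilton: `charpoly M = (X − 1)^n ⇒ (M − 1)^n = 0`. -/
theorem isNilpotent_sub_one_of_charpoly (M : Matrix (Fin n) (Fin n) K) (h : M.charpoly = (X - C 1) ^ n) :
    IsNilpotent (M - 1) := by
  refine ⟨n, ?_⟩
  have hCH := Matrix.aeval_self_charpoly M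
  rw [h, map_pow, map_sub, Polynomial.aeval_X, Polynomial.aeval_C, map_one] at hCH
  exact hCH

/-- all eigenvalues `1` ⇒ unipotent. -/
theorem isNilpotent_sub_one_of_roots_eq_one (M : Matrix (Fin n) (Fin n) K) (h : ∀ ζ, M.charpoly.IsRoot ζ → ζ = 1) :
    IsNilpotent (M - 1) :=
  isNilpotent_sub_one_of_charpoly M (charpoly_eq_X_sub_C_pow M h)
end AlgClosed

/-! ## 4. MAIN: quasi-unipotent + coefficientwise close to `(X−1)^n` at the items' radius ⇒ unipotent (over `ℚ̄_ℓ`) -/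
section Main
variable {ℓ : ℕ} [Fact ℓ.Prime] {n : ℕ}

/-- SEMISTABLE SHAPE FROM DEPTH (operator form of the certificate): a matrix `M ∈ M_n(ℚ̄_ℓ)` some power of which is unipotent
(`∃ k ≠ 0, (M^k − 1)` nilpotent — Grothendieck's quasi-unipotence of an ℓ-adic inertia image, applied to a tame generator) and whose
characteristic polynomial is coefficientwise within `(ℓ⁻¹)^n` of `(X − 1)^n` in the items' `Valued.v` currency (the avatar of a DEEP
approximant at a place where ρ is unramified: `charpoly ρ(τ) = (X−1)^n`) is UNIPOTENT. -/
theorem isNilpotent_sub_one_of_valued_lt (M : Matrix (Fin n) (Fin n) (PadicAlgCl ℓ))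
    (hq : ∃ k : ℕ, k ≠ 0 ∧ IsNilpotent (M ^ k - 1))
    (hclose : ∀ i, Valued.v ((M.charpoly - (X - C 1) ^ n).coeff i) < ((ℓ : NNReal)⁻¹) ^ n) :
    IsNilpotent (M - 1) := by
  haveI : IsAlgClosed (PadicAlgCl ℓ) := AlgebraicClosure.isAlgClosed _
  obtain ⟨k, hk, hnil⟩ := hq
  refine isNilpotent_sub_one_of_roots_eq_one M fun ζ hζ => ?_
  exact eq_one_of_valued_lt (n := n) hk (pow_eq_one_of_isRoot_charpoly M hnil hζ) hζ hclose

/-- … in eigenvalue currency this is exactly the certificate's `toyShaping_holds`; the operator form feeds the Weil–Deligne step: -/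
theorem wd_eq_one_of_valued_lt (M u : Matrix (Fin n) (Fin n) (PadicAlgCl ℓ))
    (hq : ∃ k : ℕ, k ≠ 0 ∧ IsNilpotent (M ^ k - 1))
    (hclose : ∀ i, Valued.v ((M.charpoly - (X - C 1) ^ n).coeff i) < ((ℓ : NNReal)⁻¹) ^ n)
    (hu : IsNilpotent (u - 1)) (hc : Commute M u) {m : ℕ} (hm : m ≠ 0) (hfin : (M * u) ^ m = 1) :
    M * u = 1 :=
  mul_eq_one_of_unipotent_of_pow_eq_one (isNilpotent_sub_one_of_valued_lt M hq hclose) hu hc hm hfin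

/-- and WITHOUT monodromy correction (u = 1): a quasi-unipotent, deep, finite-order inertia value is trivial — the unramified case. -/
theorem eq_one_of_valued_lt_of_pow_eq_one (M : Matrix (Fin n) (Fin n) (PadicAlgCl ℓ))
    (hclose : ∀ i, Valued.v ((M.charpoly - (X - C 1) ^ n).coeff i) < ((ℓ : NNReal)⁻¹) ^ n)
    {m : ℕ} (hm : m ≠ 0) (hfin : M ^ m = 1) : M = 1 := by
  have hq : ∃ k : ℕ, k ≠ 0 ∧ IsNilpotent (M ^ k - 1) := ⟨m, hm, by rw [hfin, sub_self]; exact IsNilpotent.zero⟩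
  exact eq_one_of_isNilpotent_sub_one_of_pow_eq_one (isNilpotent_sub_one_of_valued_lt M hq hclose) hm hfin
end Main

end Summit.Langlands.Langlands.Theorems.IwahoriTransient
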